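import Summits.QuantumFields.YangMills.Theorems.BalabanUVNodesN15KingModelCombesThomasDefect
import HarnessLib

/-!
# BalabanUVNodes ∕ N15 — THE KING-MODEL RUNG (PART Ϧ-c): THE BACKGROUND PROPAGATOR `G(U) = (−cΔ_U + m² + aQ(U)^*Q(U))⁻¹` DECAYS EXPONENTIALLY AT EVERY LINK FIELD WHERE `A₀(U)` IS
# COERCIVE — fibre blocks, entries, Dimock's bilinear form, the conjugated operator norm; in KING's SCALING `c = L²` the rate `min(1,√(κ∕(2(2(d+1)+a))))·tdist∕L` and the prefactor
# `2∕κ` depend on the coercivity constant `κ`, on `a` and on `d` ONLY (not on `L`, not on the volume, not on the fibre, not on `U`) — the tree's `King1986.Torus.kapA` shape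
# (Track A, DAG node N15 = NE2; FAN-OUT v1.1 §N15 s3 «KING-MODEL RUNG … + what the curved case adds»; count-neutral)

HONEST FRAMING.  Count-neutral (cell `pub-ymgap`, seat `pub-ymgap-dag-n15-e` g50; `--supports stmt-QuantumFields-27247 --as helper` = K3ᴬ, KEY MAP v3).  King's one-level comparison model on
ONE finite torus per spacing (`Tor (fine L M)`, blocks of side `L`, i.e. `η = L⁻¹` when `L = L₀^k`); Bałaban's one-level covariant block mean along a tree contour system (PART Ϥ-c); unitary
link fields, any fibre `𝕜ⁿ`.  `ℓ²`-Combes–Thomas: the prefactor is `1∕(κ−ρ)` per fibre block (not King's short-distance `L^∞` behaviour (3.46)∕Props 3.8–3.9), the RATE is the honest content.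
The coercivity constant `κ` is an INPUT here — PART Ϧ-d feeds the tree's sources (Ϥ-o small curvature, Ϥ-g pure gauges, Ϥ-e tree gauge, Ϥ-h small-field gauge).  NOT Bałaban's multi-level
`G_k(U)` [Balaban1985BackgroundPropagators] (3.15) nor his random-walk expansion (3.47)–(3.55); NOT a node discharge (N15 of record untouched); nothing continuum ∕ ℝ⁴ ∕ OS ∕ Clay.

THE RESULTS (`T` a tree contour system on the `L`-blocks, `M` the block torus, `U` unitary, `a, c ≥ 0`, any `m²`; HYPOTHESIS `κΣ‖v_x‖² ≤ Re⟨v,A₀(U)v⟩` for all `v`, `κ > 0`;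
`d(x,y) = tdistT` the sup-circular torus distance of the fine torus; `G(U) := A₀(U)⁻¹`):
* §1 GENERAL `c` (weight `ctW L M κ_w y`, defect `ρ(κ_w) := 2(d+1)c(cosh(κ_w∕L) − 1) + a(cosh κ_w − 1) < κ`): `isUnit_fullOpU_of_coercive`, ★★★★ **`norm_blk_fullOpU_inv_le`**
  (`‖blk G(U) x y‖ ≤ (κ − ρ)⁻¹·e^{−(κ_w∕L)·d(x,y)}`), `norm_fullOpU_inv_entry_le`, ★★★ `l2_opNorm_wtConj_fullOpU_inv_le` (`‖e^{ctW}G(U)e^{−ctW}‖ ≤ (κ−ρ)⁻¹`, any centre), ★★★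
  **`norm_star_dotProduct_fullOpU_inv_mulVec_le`** (Dimock's Lemma 30 form: `|⟨f,G(U)g⟩| ≤ (κ−ρ)⁻¹‖e^{−ctW}f‖‖e^{ctW}g‖`).
* §2 KING's SCALING `c = L²`: def `ctRate κ a d = min(1, √(κ∕(2(2(d+1)+a))))`, `ctRate_pos`, `ctRate_le_one`, ★ `rho_king_le_sq` (`2(d+1)L²(cosh(κ_w∕L)−1) + a(cosh κ_w−1) ≤ (2(d+1)+a)κ_w²`
  for `0 ≤ κ_w ≤ 1 ≤ L` — the tree's `Beta.CombesThomasForm.inv_sq_mul_cosh_sub_one_le`), ★ `rho_ctRate_le_half` (`≤ κ∕2` at `κ_w = ctRate`), `ctRate_gamA` (`ctRate(γ_A, a, d) = King1986.Torus.kapA a (d+1)`: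
  at the flat floor the rate IS the tree's `U ≡ 1` rate);
  ★★★★ **`norm_blk_fullOpU_inv_le_king`** — `‖blk (L²(−Δ_U) + m² + aQ(U)^*Q(U))⁻¹ x y‖ ≤ (2∕κ)·e^{−ctRate·d(x,y)∕L}` for EVERY `L ≥ 1`, every volume `M`, every fibre, every unitary `U` with a
  `κ`-coercive `A₀(U)`; `norm_fullOpU_inv_entry_le_king`; ★★★ `norm_star_dotProduct_fullOpU_inv_mulVec_le_king`; ★★★ `l2_opNorm_wtConj_fullOpU_inv_le_king`.
* §3 BLOCK CURRENCY (the tree's `mul_tdistT_blocks_le`: `L·d_M(b,b′) ≤ d(x,x′) + (L−1)`): ★★★ **`norm_blk_fullOpU_inv_le_king_blocks`** — `‖blk G(U) x x′‖ ≤ (2∕κ)e·e^{−ctRate·d_M(B(x),B(x′))}`: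
  decay at rate `ctRate` PER BLOCK of separation, i.e. per unit of physical distance — `η`-UNIFORM.
PRIOR TREE ART (by name, not restated): Ϧ-a (`wtConj`, `norm_blk_inv_le_of_conjCoercive`, `norm_inv_entry_le_of_conjCoercive`, `norm_star_dotProduct_inv_mulVec_le`, `l2_opNorm_wtConj_inv_le`,
`isUnit_of_reCoercive`), Ϧ-b (`re_conjForm_fullOpU_ctW_ge`), Ϥ-d (`fullOpU`), `King1986.Torus` (`ctW`, `tdistT`, `tdistT_self`, `tdistT_nonneg`, `mul_tdistT_blocks_le`, `exists_eq_site`, `gamA`, `kapA`),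
`QuantumLattice.cosh_sub_one_le_sq_of_abs_le_one`, `Beta.CombesThomasForm.inv_sq_mul_cosh_sub_one_le`.  Dedup (rg at filing): basename 0 files; needles `ctRate|norm_blk_fullOpU_inv|isUnit_fullOpU_of_coercive`
0 tree files.  Locators: [Dimock2013] App. D Lemma 30 «|⟨f,G_k(Ω)f′⟩| ≤ O(1)e^{−δ₀d(y,y′)}‖f‖₂‖f′‖₂» (there: `A = 0`, Neumann cubes); [King1986] (4.33) p.674 «|G_k(x,y)| ≤ O(1)d(x,y)^{−(d−1)}e^{−δd(x,y)}»
(shape; our `ℓ²` prefactor replaces the short-distance factor), (2.13) p.653, (4.5) p.670; [Balaban1985BackgroundPropagators] Thm 3.1∕(3.39)∕(3.46) p.397–398 (shape of the conclusion at regular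
`U`; the regularity enters only through `κ`, PART Ϧ-d).  0 `sorry`, 1 `def`.
-/

noncomputable section
open scoped BigOperators ComplexConjugate ComplexOrder InnerProductSpace Matrix.Norms.L2Operator
open Finset Matrix WithLp

namespace Summit.QuantumFields.YangMills.BalabanUVNodes.N15KingModelRung.CombesThomas

open Literature.MathematicalPhysics.QuantumFieldTheory.LatticeDiamagneticInequality (blk)
open Literature.MathematicalPhysics.QuantumFieldTheory.Balaban1983to89.B5Prop11Plancherel (Tor fine unitVec)
open Literature.MathematicalPhysics.QuantumFieldTheory.King1986.Torus
  (site blockOf blockOf_site blockEquiv blockEquiv_apply ctW tdistT tdistT_self tdistT_nonneg mul_tdistT_blocks_le exists_eq_site gamA gamA_pos kapA)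
open Literature.MathematicalPhysics.QuantumLattice (cosh_sub_one_le_sq_of_abs_le_one)
open Summit.QuantumFields.YangMills.BalabanUVNodes.N15KingModelRung.Covariant (fib fib_apply norm_apply_le_norm_fib sum_norm_fib_sq)
open Summit.QuantumFields.YangMills.BalabanUVNodes.N15KingModelRung.Curvature (expWt)
open Summit.QuantumFields.YangMills.BalabanUVNodes.N15KingModelRung.CovariantBlock (BlockTree covQ fullOpU)

variable {d : ℕ} {L : ℕ} [NeZero L] (T : BlockTree d L) (M : Fin (d + 1) → ℕ) [hM : ∀ μ, NeZero (M μ)]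
variable {𝕜 : Type*} [RCLike 𝕜] {n : Type*} [Fintype n] [DecidableEq n]

/-! ## §1 General `c`: coercivity ⟹ decay of every fibre block of `G(U)` -/

section General

/-- The weight `ctW L M κ_w y` read between `x` and its centre `y`: `ctW(x) − ctW(y) = (κ_w∕L)·d(x,y)`. [folklore] -/
theorem ctW_sub_ctW_centre (κw : ℝ) (x y : Tor (fine L M)) : ctW L M κw y x - ctW L M κw y y = κw / L * tdistT (fine L M) x y := by
  rw [ctW, ctW, tdistT_self, mul_zero, sub_zero]

variable {a c : ℝ} (ha : 0 ≤ a) (hc : 0 ≤ c) (m2 : ℝ) {U : Tor (fine L M) × Fin (d + 1) → Matrix n n 𝕜} (hU : ∀ bd, U bd ∈ Matrix.unitaryGroup n 𝕜)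
  {κ : ℝ} (hcoer : ∀ v : Tor (fine L M) × n → 𝕜, κ * ∑ x, ‖fib (fine L M) v x‖ ^ 2 ≤ RCLike.re (star v ⬝ᵥ (fullOpU T M a c m2 U *ᵥ v)))
include ha hc hU hcoer

omit ha hc hU in
/-- A `κ`-coercive full operator (`κ > 0`) is invertible: `G(U) = A₀(U)⁻¹` exists. [cite: Balaban1985BackgroundPropagators, (3.27) p.395] -/
theorem isUnit_fullOpU_of_coercive (hκ : 0 < κ) : IsUnit (fullOpU T M a c m2 U) := isUnit_of_reCoercive (fine L M) hκ hcoer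

/-- ★★★★ **COERCIVITY ⟹ EXPONENTIAL DECAY OF THE FULL BACKGROUND PROPAGATOR (fibre blocks)**: for every `κ_w ≥ 0` with `ρ := 2(d+1)c(cosh(κ_w∕L) − 1) + a(cosh κ_w − 1) < κ`:
`‖blk G(U) x y‖ ≤ (κ − ρ)⁻¹·e^{−(κ_w∕L)·d(x,y)}` for ALL sites — every unitary `U` at which `A₀(U)` is `κ`-coercive, every volume, every fibre.
[cite: Dimock2013, App. D, Lemma 30; King1986, (4.33) p.674; Balaban1985BackgroundPropagators, (3.39) p.397] -/
theorem norm_blk_fullOpU_inv_le {κw : ℝ} (hκw : 0 ≤ κw) (hρ : 2 * ((d : ℝ) + 1) * c * (Real.cosh (κw / L) - 1) + a * (Real.cosh κw - 1) < κ) (x y : Tor (fine L M)) :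
    ‖blk (fullOpU T M a c m2 U)⁻¹ x y‖
      ≤ (κ - 2 * ((d : ℝ) + 1) * c * (Real.cosh (κw / L) - 1) - a * (Real.cosh κw - 1))⁻¹ * Real.exp (-(κw / L * tdistT (fine L M) x y)) := by
  have h := norm_blk_inv_le_of_conjCoercive (fine L M) (T := fullOpU T M a c m2 U) (φ := ctW L M κw y) (by linarith) (re_conjForm_fullOpU_ctW_ge T M ha hc m2 hU hcoer hκw y) x y
  rwa [ctW_sub_ctW_centre] at h

/-- The same for entries: `|G(U)((x,i),(y,j))| ≤ (κ − ρ)⁻¹e^{−(κ_w∕L)d(x,y)}`. [cite: King1986, (4.33) p.674; Balaban1985BackgroundPropagators, (3.39) p.397] -/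
theorem norm_fullOpU_inv_entry_le {κw : ℝ} (hκw : 0 ≤ κw) (hρ : 2 * ((d : ℝ) + 1) * c * (Real.cosh (κw / L) - 1) + a * (Real.cosh κw - 1) < κ) (x y : Tor (fine L M)) (i j : n) :
    ‖(fullOpU T M a c m2 U)⁻¹ (x, i) (y, j)‖
      ≤ (κ - 2 * ((d : ℝ) + 1) * c * (Real.cosh (κw / L) - 1) - a * (Real.cosh κw - 1))⁻¹ * Real.exp (-(κw / L * tdistT (fine L M) x y)) :=
  (norm_entry_le_norm_blk _ i j).trans (norm_blk_fullOpU_inv_le T M ha hc m2 hU hcoer hκw hρ x y)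

/-- ★★★ THE CONJUGATED PROPAGATOR IS BOUNDED for every centre `x₀`: `‖e^{ctW}G(U)e^{−ctW}‖ ≤ (κ − ρ)⁻¹`. [cite: Dimock2013, App. D, proof of Lemma 30] -/
theorem l2_opNorm_wtConj_fullOpU_inv_le {κw : ℝ} (hκw : 0 ≤ κw) (hρ : 2 * ((d : ℝ) + 1) * c * (Real.cosh (κw / L) - 1) + a * (Real.cosh κw - 1) < κ) (x₀ : Tor (fine L M)) :
    ‖wtConj (fine L M) (ctW L M κw x₀) (fullOpU T M a c m2 U)⁻¹‖ ≤ (κ - 2 * ((d : ℝ) + 1) * c * (Real.cosh (κw / L) - 1) - a * (Real.cosh κw - 1))⁻¹ :=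
  l2_opNorm_wtConj_inv_le (fine L M) (by linarith) (re_conjForm_fullOpU_ctW_ge T M ha hc m2 hU hcoer hκw x₀)

/-- ★★★ **DIMOCK's LEMMA 30 FOR THE COVARIANT FULL PROPAGATOR**: for every centre `x₀` and all fields `f, g`,
`|⟨f, G(U)g⟩| ≤ (κ − ρ)⁻¹·‖e^{−ctW}f‖·‖e^{ctW}g‖` (`ctW = (κ_w∕L)d(·,x₀)`) — for `f`, `g` supported near blocks `y`, `y′` this is `O(1)e^{−κ_w d_M(y,y′)}‖f‖‖g‖` (PART Ϧ-e).
[cite: Dimock2013, App. D, Lemma 30 (usher1.5)] -/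
theorem norm_star_dotProduct_fullOpU_inv_mulVec_le {κw : ℝ} (hκw : 0 ≤ κw) (hρ : 2 * ((d : ℝ) + 1) * c * (Real.cosh (κw / L) - 1) + a * (Real.cosh κw - 1) < κ) (x₀ : Tor (fine L M))
    (f g : Tor (fine L M) × n → 𝕜) :
    ‖star f ⬝ᵥ ((fullOpU T M a c m2 U)⁻¹ *ᵥ g)‖
      ≤ (κ - 2 * ((d : ℝ) + 1) * c * (Real.cosh (κw / L) - 1) - a * (Real.cosh κw - 1))⁻¹
        * ‖(toLp 2 (expWt (fine L M) (fun x => -ctW L M κw x₀ x) f) : EuclideanSpace 𝕜 (Tor (fine L M) × n))‖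
        * ‖(toLp 2 (expWt (fine L M) (ctW L M κw x₀) g) : EuclideanSpace 𝕜 (Tor (fine L M) × n))‖ :=
  norm_star_dotProduct_inv_mulVec_le (fine L M) (by linarith) (re_conjForm_fullOpU_ctW_ge T M ha hc m2 hU hcoer hκw x₀) f g

end General

/-! ## §2 King's scaling `c = L²`: `L`-free defect, the rate `ctRate`, the `U`-`L`-volume-uniform decay theorem -/

section King

/-- THE COMBES–THOMAS RATE at coercivity `κ` (King's scaling): `κ_w = min(1, √(κ∕(2(2(d+1)+a))))` — the tree's `King1986.Torus.kapA` with `γ_A` replaced by an arbitrary floor `κ`. [folklore] -/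
def ctRate (κ a : ℝ) (d : ℕ) : ℝ := min 1 (Real.sqrt (κ / (2 * (2 * ((d : ℝ) + 1) + a))))

/-- `0 < κ_w` for `κ > 0`, `a ≥ 0`. [folklore] -/
theorem ctRate_pos {κ a : ℝ} (hκ : 0 < κ) (ha : 0 ≤ a) (d : ℕ) : 0 < ctRate κ a d := by
  unfold ctRate
  exact lt_min one_pos (Real.sqrt_pos.mpr (by positivity))

/-- `κ_w ≤ 1`. [folklore] -/
theorem ctRate_le_one (κ a : ℝ) (d : ℕ) : ctRate κ a d ≤ 1 := min_le_left _ _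

/-- `0 ≤ κ_w`. [folklore] -/
theorem ctRate_nonneg (κ a : ℝ) (d : ℕ) : 0 ≤ ctRate κ a d := le_min zero_le_one (Real.sqrt_nonneg _)

/-- AT THE FLAT FLOOR THE RATE IS THE TREE's: `ctRate(γ_A, a, d) = kapA a (d+1)` (`γ_A = gamA a (d+1)`, [Dimock2013] Lemma 29∕30 in King's normalisation). [cite: Dimock2013, App. D, Lemma 30] -/
theorem ctRate_gamA (a : ℝ) (d : ℕ) : ctRate (gamA a (d + 1)) a d = kapA a (d + 1) := by
  unfold ctRate kapA
  push_cast
  rfl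

/-- ★ **THE DEFECT IS `L`-FREE IN KING's SCALING**: for `0 ≤ κ_w ≤ 1 ≤ L`, `2(d+1)L²(cosh(κ_w∕L) − 1) + a(cosh κ_w − 1) ≤ (2(d+1) + a)κ_w²` — the bond coefficient `L² = η⁻²` is compensated by the
oscillation `κ_w∕L` per bond (the tree's `inv_sq_mul_cosh_sub_one_le`), the block term by `cosh κ_w − 1 ≤ κ_w²`. [cite: Dimock2013, App. D, proof of Lemma 30 (city1)] -/
theorem rho_king_le_sq {L : ℕ} (hL : 1 ≤ L) {a : ℝ} (ha : 0 ≤ a) {κw : ℝ} (hκw0 : 0 ≤ κw) (hκw1 : κw ≤ 1) :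
    2 * ((d : ℝ) + 1) * (L : ℝ) ^ 2 * (Real.cosh (κw / L) - 1) + a * (Real.cosh κw - 1) ≤ (2 * ((d : ℝ) + 1) + a) * κw ^ 2 := by
  have hL0 : (0 : ℝ) < L := by exact_mod_cast hL
  have hκL : κw * (L : ℝ)⁻¹ ≤ 1 := by
    rw [mul_inv_le_iff₀ hL0, one_mul]
    exact hκw1.trans (by exact_mod_cast hL)
  have h1 : ((L : ℝ) ^ 2) * (Real.cosh (κw / L) - 1) ≤ κw ^ 2 := by
    have h := Literature.MathematicalPhysics.QuantumFieldTheory.Balaban1983to89.Beta.CombesThomasForm.inv_sq_mul_cosh_sub_one_le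
      (η := (L : ℝ)⁻¹) (δ := κw) (t := κw / L) (inv_pos.mpr hL0) (by rw [abs_of_nonneg (by positivity), div_eq_mul_inv]) hκL
    rwa [inv_pow, inv_inv] at h
  have h2 : Real.cosh κw - 1 ≤ κw ^ 2 := cosh_sub_one_le_sq_of_abs_le_one (by rw [abs_of_nonneg hκw0]; exact hκw1)
  have h3 : 2 * ((d : ℝ) + 1) * (L : ℝ) ^ 2 * (Real.cosh (κw / L) - 1) ≤ 2 * ((d : ℝ) + 1) * κw ^ 2 := by
    have : 2 * ((d : ℝ) + 1) * (L : ℝ) ^ 2 * (Real.cosh (κw / L) - 1) = 2 * ((d : ℝ) + 1) * (((L : ℝ) ^ 2) * (Real.cosh (κw / L) - 1)) := by ring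
    rw [this]; exact mul_le_mul_of_nonneg_left h1 (by positivity)
  nlinarith [mul_le_mul_of_nonneg_left h2 ha]

/-- ★ AT THE RATE `ctRate` THE DEFECT IS AT MOST HALF THE FLOOR: `(2(d+1)+a)·ctRate² ≤ κ∕2` (`κ > 0`, `a ≥ 0`). [folklore] -/
theorem rho_ctRate_le_half {κ a : ℝ} (hκ : 0 < κ) (ha : 0 ≤ a) (d : ℕ) : (2 * ((d : ℝ) + 1) + a) * ctRate κ a d ^ 2 ≤ κ / 2 := by
  have hpos : 0 < 2 * (2 * ((d : ℝ) + 1) + a) := by positivity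
  have h1 : ctRate κ a d ^ 2 ≤ κ / (2 * (2 * ((d : ℝ) + 1) + a)) := by
    calc ctRate κ a d ^ 2 ≤ Real.sqrt (κ / (2 * (2 * ((d : ℝ) + 1) + a))) ^ 2 := pow_le_pow_left₀ (ctRate_nonneg κ a d) (min_le_right _ _) 2
      _ = κ / (2 * (2 * ((d : ℝ) + 1) + a)) := Real.sq_sqrt (by positivity)
  calc (2 * ((d : ℝ) + 1) + a) * ctRate κ a d ^ 2 ≤ (2 * ((d : ℝ) + 1) + a) * (κ / (2 * (2 * ((d : ℝ) + 1) + a))) := mul_le_mul_of_nonneg_left h1 (by positivity)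
    _ = κ / 2 := by field_simp

/-- The King-scaling defect at the rate `ctRate` leaves half the floor: `κ∕2 ≤ κ − ρ(ctRate)` (`L ≥ 1`). [folklore] -/
theorem half_le_sub_rho_ctRate {L : ℕ} (hL : 1 ≤ L) {κ a : ℝ} (hκ : 0 < κ) (ha : 0 ≤ a) :
    κ / 2 ≤ κ - 2 * ((d : ℝ) + 1) * (L : ℝ) ^ 2 * (Real.cosh (ctRate κ a d / L) - 1) - a * (Real.cosh (ctRate κ a d) - 1) := by
  have h1 := rho_king_le_sq (d := d) hL ha (ctRate_nonneg κ a d) (ctRate_le_one κ a d)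
  have h2 := rho_ctRate_le_half hκ ha d
  linarith

variable {a : ℝ} (ha : 0 ≤ a) (m2 : ℝ) {U : Tor (fine L M) × Fin (d + 1) → Matrix n n 𝕜} (hU : ∀ bd, U bd ∈ Matrix.unitaryGroup n 𝕜)
  {κ : ℝ} (hκ : 0 < κ) (hcoer : ∀ v : Tor (fine L M) × n → 𝕜, κ * ∑ x, ‖fib (fine L M) v x‖ ^ 2 ≤ RCLike.re (star v ⬝ᵥ (fullOpU T M a ((L : ℝ) ^ 2) m2 U *ᵥ v)))
include ha hU hκ hcoer

/-- ★★★★ **THE `η`-UNIFORM DECAY OF KING's ∕ BAŁABAN's FULL BACKGROUND PROPAGATOR AT A COERCIVE LINK FIELD**: in King's scaling `A₀(U) = L²(−Δ_U) + m² + aQ(U)^*Q(U)`, for EVERY `L ≥ 1`, every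
volume, every fibre, every unitary `U` with `κΣ‖v_x‖² ≤ Re⟨v,A₀(U)v⟩`:  `‖blk G(U) x y‖ ≤ (2∕κ)·e^{−ctRate(κ,a,d)·d(x,y)∕L}` — rate and prefactor depend on `κ, a, d` only; `d(x,y)∕L` is the
distance in block (physical) units. [cite: King1986, (4.33) p.674; Dimock2013, App. D, Lemma 30; Balaban1985BackgroundPropagators, Thm 3.1 ∕ (3.46) p.398] -/
theorem norm_blk_fullOpU_inv_le_king (hL : 1 ≤ L) (x y : Tor (fine L M)) :
    ‖blk (fullOpU T M a ((L : ℝ) ^ 2) m2 U)⁻¹ x y‖ ≤ 2 / κ * Real.exp (-(ctRate κ a d / L * tdistT (fine L M) x y)) := by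
  have hhalf := half_le_sub_rho_ctRate (d := d) hL hκ ha
  have hρ : 2 * ((d : ℝ) + 1) * (L : ℝ) ^ 2 * (Real.cosh (ctRate κ a d / L) - 1) + a * (Real.cosh (ctRate κ a d) - 1) < κ := by linarith
  have h := norm_blk_fullOpU_inv_le T M ha (by positivity) m2 hU hcoer (ctRate_nonneg κ a d) hρ x y
  refine h.trans (mul_le_mul_of_nonneg_right ?_ (Real.exp_nonneg _))
  rw [show (2 : ℝ) / κ = (κ / 2)⁻¹ by rw [inv_div]]
  exact inv_anti₀ (by positivity) hhalf

/-- Entries: `|G(U)((x,i),(y,j))| ≤ (2∕κ)e^{−ctRate·d(x,y)∕L}`. [cite: King1986, (4.33) p.674] -/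
theorem norm_fullOpU_inv_entry_le_king (hL : 1 ≤ L) (x y : Tor (fine L M)) (i j : n) :
    ‖(fullOpU T M a ((L : ℝ) ^ 2) m2 U)⁻¹ (x, i) (y, j)‖ ≤ 2 / κ * Real.exp (-(ctRate κ a d / L * tdistT (fine L M) x y)) :=
  (norm_entry_le_norm_blk _ i j).trans (norm_blk_fullOpU_inv_le_king T M ha m2 hU hκ hcoer hL x y)

/-- ★★★ The conjugated propagator in King's scaling: `‖e^{ctW}G(U)e^{−ctW}‖ ≤ 2∕κ` at the rate `ctRate`, every centre, every `L ≥ 1`. [cite: Dimock2013, App. D, proof of Lemma 30] -/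
theorem l2_opNorm_wtConj_fullOpU_inv_le_king (hL : 1 ≤ L) (x₀ : Tor (fine L M)) :
    ‖wtConj (fine L M) (ctW L M (ctRate κ a d) x₀) (fullOpU T M a ((L : ℝ) ^ 2) m2 U)⁻¹‖ ≤ 2 / κ := by
  have hhalf := half_le_sub_rho_ctRate (d := d) hL hκ ha
  have hρ : 2 * ((d : ℝ) + 1) * (L : ℝ) ^ 2 * (Real.cosh (ctRate κ a d / L) - 1) + a * (Real.cosh (ctRate κ a d) - 1) < κ := by linarith
  refine (l2_opNorm_wtConj_fullOpU_inv_le T M ha (by positivity) m2 hU hcoer (ctRate_nonneg κ a d) hρ x₀).trans ?_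
  rw [show (2 : ℝ) / κ = (κ / 2)⁻¹ by rw [inv_div]]
  exact inv_anti₀ (by positivity) hhalf

/-- ★★★ **DIMOCK's LEMMA 30 IN KING's SCALING AT EVERY COERCIVE LINK FIELD**: `|⟨f, G(U)g⟩| ≤ (2∕κ)‖e^{−ctW}f‖‖e^{ctW}g‖` with `ctW = (ctRate∕L)·d(·,x₀)`, every centre `x₀`, every `L ≥ 1`.
[cite: Dimock2013, App. D, Lemma 30 (usher1.5); King1986, (4.34) p.674] -/
theorem norm_star_dotProduct_fullOpU_inv_mulVec_le_king (hL : 1 ≤ L) (x₀ : Tor (fine L M)) (f g : Tor (fine L M) × n → 𝕜) :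
    ‖star f ⬝ᵥ ((fullOpU T M a ((L : ℝ) ^ 2) m2 U)⁻¹ *ᵥ g)‖
      ≤ 2 / κ * ‖(toLp 2 (expWt (fine L M) (fun x => -ctW L M (ctRate κ a d) x₀ x) f) : EuclideanSpace 𝕜 (Tor (fine L M) × n))‖
        * ‖(toLp 2 (expWt (fine L M) (ctW L M (ctRate κ a d) x₀) g) : EuclideanSpace 𝕜 (Tor (fine L M) × n))‖ := by
  have hhalf := half_le_sub_rho_ctRate (d := d) hL hκ ha
  have hρ : 2 * ((d : ℝ) + 1) * (L : ℝ) ^ 2 * (Real.cosh (ctRate κ a d / L) - 1) + a * (Real.cosh (ctRate κ a d) - 1) < κ := by linarith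
  refine (norm_star_dotProduct_fullOpU_inv_mulVec_le T M ha (by positivity) m2 hU hcoer (ctRate_nonneg κ a d) hρ x₀ f g).trans ?_
  refine mul_le_mul_of_nonneg_right (mul_le_mul_of_nonneg_right ?_ (norm_nonneg _)) (norm_nonneg _)
  rw [show (2 : ℝ) / κ = (κ / 2)⁻¹ by rw [inv_div]]
  exact inv_anti₀ (by positivity) hhalf

/-! ## §3 Block currency: decay per block of separation -/

/-- ★★★ **DECAY IN THE BLOCK DISTANCE (physical units)**: `‖blk G(U) x x′‖ ≤ (2∕κ)·e·e^{−ctRate·d_M(B(x),B(x′))}` — one factor `e^{−ctRate}` per block of separation between the blocks of `x`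
and `x′`, for every `L ≥ 1`: the rate per unit PHYSICAL distance is `L`-free (`η`-uniform). [cite: King1986, (4.33)–(4.34) p.674; Dimock2013, App. D, Lemma 30 (coin)] -/
theorem norm_blk_fullOpU_inv_le_king_blocks (hL : 1 ≤ L) (x x' : Tor (fine L M)) :
    ‖blk (fullOpU T M a ((L : ℝ) ^ 2) m2 U)⁻¹ x x'‖ ≤ 2 / κ * Real.exp 1 * Real.exp (-(ctRate κ a d * tdistT M (blockOf L M x) (blockOf L M x'))) := by
  have hL0 : (0 : ℝ) < L := by exact_mod_cast hL
  set δ := ctRate κ a d with hδ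
  have hδ0 : 0 ≤ δ := ctRate_nonneg κ a d
  have hδ1 : δ ≤ 1 := ctRate_le_one κ a d
  obtain ⟨j, hj⟩ := exists_eq_site L M x
  obtain ⟨j', hj'⟩ := exists_eq_site L M x'
  have hblocks : (L : ℝ) * tdistT M (blockOf L M x) (blockOf L M x') ≤ tdistT (fine L M) x x' + ((L : ℝ) - 1) := by
    have h := mul_tdistT_blocks_le L M (blockOf L M x) (blockOf L M x') j j'
    rwa [← hj, ← hj'] at h
  have h1 := norm_blk_fullOpU_inv_le_king T M ha m2 hU hκ hcoer hL x x'
  refine h1.trans ?_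
  rw [mul_assoc]
  refine mul_le_mul_of_nonneg_left ?_ (by positivity)
  rw [← Real.exp_add]
  refine Real.exp_le_exp.mpr ?_
  -- `−(δ/L)d(x,x′) ≤ 1 − δ d_M`: from `L d_M ≤ d + (L−1)` and `δ ≤ 1`
  have h2 : δ * tdistT M (blockOf L M x) (blockOf L M x') ≤ δ / L * tdistT (fine L M) x x' + δ * (((L : ℝ) - 1) / L) := by
    have := mul_le_mul_of_nonneg_left hblocks (div_nonneg hδ0 hL0.le)
    calc δ * tdistT M (blockOf L M x) (blockOf L M x') = δ / L * ((L : ℝ) * tdistT M (blockOf L M x) (blockOf L M x')) := by field_simp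
      _ ≤ δ / L * (tdistT (fine L M) x x' + ((L : ℝ) - 1)) := this
      _ = δ / L * tdistT (fine L M) x x' + δ * (((L : ℝ) - 1) / L) := by ring
  have h3 : δ * (((L : ℝ) - 1) / L) ≤ 1 := by
    have h4 : ((L : ℝ) - 1) / L ≤ 1 := by rw [div_le_one hL0]; linarith
    have h5 : 0 ≤ ((L : ℝ) - 1) / L := div_nonneg (by linarith [show (1 : ℝ) ≤ L by exact_mod_cast hL]) hL0.le
    nlinarith
  linarith

end King

end Summit.QuantumFields.YangMills.BalabanUVNodes.N15KingModelRung.CombesThomas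

end
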